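import Summits.ABC.ABC.Theses.IsogenyGlueCongruence
import Summits.ABC.ABC.Theorems.IsogenyGlueCongruenceSharpDegreeOfPolyDegreeOfAbc
import Summits.ABC.ABC.Theorems.IsogenyGlueCongruenceSharpDegreeOfPolyDegreeOfTarget
import Summits.ABC.ABC.Theorems.IsogenyGlueCongruenceFrameOverPetersson
import Summits.ABC.ABC.Theorems.SharpDegreeOfPolyDegree.Negative.LogicalPosition
import Summits.ABC.ABC.Theorems.SharpDegreeOfPolyDegree.Negative.ExponentFloor
import Literature.NumberTheory.EllipticCurves.DegreeConjectureAbcSemistable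
import Literature.NumberTheory.EllipticCurves.SilvermanHeightCovolumeProofs

set_option linter.dupNamespace false

/-!
# EXEMPT-46 re-examination (crux-strategist r1) — crux stmt-ABC-10895 `SharpDegreeOfPolyDegree`

Kernel-checked companion of `STRATEGY-CENSUS.md` (re-exam of 2026-08-17, strategist seat
`planner-cstrat-stmt-ABC-10895-r1-0`).  `R := SharpDegreeOfPolyDegree = (Poly → X)`,
`X := SemistableDegreeConjecture`, `S := _root_.ABC`.

The re-audit bins `R` as RESTATED (landed `stub_ofAbc : BoundedManin → S → R`).  Under the BC2
REDIRECT exemption (human rulings 2026-08-16 20:3x / 21:1x / 23:0x CDT) `R` would pass only through a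
typed decomposition `X₁ ∧ … ∧ X_k → R` with (a) `k ≥ 2` load-bearing pieces, (b) the assembly PROVED
(a trivial seam is fine), (c) no piece giving `S` or `R` on its own (cheap probes fail, no landed iff,
bridge piece `T` substantive), (d) a registered skeleton or live line for every OPEN piece.

This file types the candidate decompositions D0, D1, D2, D5, D6 of the census, PROVES every assembly
(criterion (b)), and kernel-checks the facts that decide criterion (c):

* D0 (bridge through the target `X`): piece `X → R` is proved (`stub_ofTarget`), piece `X` gives `S`
  (`frameOverPetersson_proof`, modulo the item `PeterssonLowerBound`) — (c) fails / RULE-N.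
* D6 (bridge through the summit): piece `Poly → S` is `R` itself modulo the four named inputs
  (`sharpDegreeOfPolyDegree_iff_poly_imp_abc_of_facts`, landed p99967), piece `S → X` is proved modulo
  three named known-in-print inputs — (c) fails / RULE-N.
* D5 (the two faces of generalized Szpiro): **NEW** `abc_of_c4Sharp` — the sharp `c₄`-face
  `|c₄|³ ≤ C(ε) N^{6+ε}` for semistable curves ALONE implies the summit (Frey–Hellegouarch curve in
  Serre's normalisation: `c² ≤ 2 c₄'`, `N ∣ rad(abc)`), hence `C4SharpOfPoly ↔ R` modulo the four
  named inputs (`c4SharpOfPoly_iff_crux_of_facts`) and the glue piece `TargetOfFaces` is proved with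
  the `Δ`-face IDLE — (c) fails for the `c₄`-piece.
* D1 (the `Δ / c₄` seam, `DiscSharpOfPoly ∧ SharpOfDiscSharp`): both pieces are consequences of `R`
  (`discSharpOfPoly_of_crux`, `sharpOfDiscSharp_of_crux`), neither is known to give `R`; the second
  piece is EXACTLY the Hall face `Poly → DiscSharp → C4Sharp` modulo the named inputs
  (`sharpOfDiscSharp_iff_hallFace_of_facts`) — (c) passes, (d) is decided in the census (no plan).
* D2 (exponent ladder at a waypoint `κ₁`): both pieces are consequences of `R`
  (`ladderUp_of_crux`, `ladderDown_of_crux`); the lower piece is free for `κ₁ ≤ 2`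
  (`ladderDown_of_le_two`) and the upper piece is `¬ Poly` for `κ₁ < 3/2` (`ladderUp_iff_not_poly`)
  — (c) passes for `κ₁ > 2`, (d) is decided in the census (no plan: each piece is a fixed-exponent
  drop of the kind `R` is made of, cf. the strategist-s1 theorem `ExponentDescent ↔ R`).

No `sorry`; no named facts introduced; theorems only besides the piece abbreviations.
-/

noncomputable section

namespace Summit.ABC.ABC.Cruxes.SharpDegreeOfPolyDegree.ReExam46

open Summit.ABC.ABC.Theses.IsogenyGlueCongruence
open Literature.NumberTheory.EllipticCurves Literature.NumberTheory.EllipticCurves.ModularForms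
open Literature.NumberTheory.DiophantineGeometry Literature.NumberTheory.Automorphic
open WeierstrassCurve CongruenceSubgroup UniqueFactorizationMonoid

/-! ## §0 The pieces, named -/

/-- The antecedent of `R`: the polynomial modular-degree conjecture for semistable curves
(verbatim the hypothesis of `SharpDegreeOfPolyDegree`). [folklore] -/
def Poly : Prop :=
  ∃ κ C : ℝ, ∀ (W : WeierstrassCurve ℚ) [W.IsElliptic] [W.IsGloballyMinimal]
    [NeZero (W.conductorNorm ℤ)], W.IsSemistable ℤ →
      ∃ D : ModularParametrizationData W (W.conductorNorm ℤ),
        (D.modularDegree : ℝ) ≤ C * (W.conductorNorm ℤ : ℝ) ^ κ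

/-- The polynomial modular-degree bound at a fixed exponent `κ`. [folklore] -/
def DegAt (κ : ℝ) : Prop :=
  ∃ C : ℝ, ∀ (W : WeierstrassCurve ℚ) [W.IsElliptic] [W.IsGloballyMinimal]
    [NeZero (W.conductorNorm ℤ)], W.IsSemistable ℤ →
      ∃ D : ModularParametrizationData W (W.conductorNorm ℤ),
        (D.modularDegree : ℝ) ≤ C * (W.conductorNorm ℤ : ℝ) ^ κ

/-- Sharp Szpiro, DISCRIMINANT face, for semistable curves in global minimal form:
`|Δ_W| ≤ C(ε) · N^{6+ε}`. [folklore] -/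
def DiscSharp : Prop :=
  ∀ ε : ℝ, 0 < ε → ∃ C : ℝ, ∀ (W : WeierstrassCurve ℚ) [W.IsElliptic] [W.IsGloballyMinimal]
    [NeZero (W.conductorNorm ℤ)], W.IsSemistable ℤ →
      ((|W.Δ| : ℚ) : ℝ) ≤ C * (W.conductorNorm ℤ : ℝ) ^ (6 + ε)

/-- Sharp Szpiro, `c₄` (HALL) face, for semistable curves in global minimal form:
`|c₄(W)|³ ≤ C(ε) · N^{6+ε}`. [folklore] -/
def C4Sharp : Prop :=
  ∀ ε : ℝ, 0 < ε → ∃ C : ℝ, ∀ (W : WeierstrassCurve ℚ) [W.IsElliptic] [W.IsGloballyMinimal]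
    [NeZero (W.conductorNorm ℤ)], W.IsSemistable ℤ →
      ((|W.c₄| ^ 3 : ℚ) : ℝ) ≤ C * (W.conductorNorm ℤ : ℝ) ^ (6 + ε)

/-- The crux is `Poly → X`, definitionally. [folklore] -/
theorem crux_iff : SharpDegreeOfPolyDegree ↔ (Poly → SemistableDegreeConjecture) := Iff.rfl

/-- `Poly = ∃ κ, DegAt κ`. [folklore] -/
theorem poly_iff : Poly ↔ ∃ κ, DegAt κ := Iff.rfl

/-! ## §1 D0 — the bridge through the target `X` (`X ∧ (X → R)`) -/

/-- D0 assembly (modus ponens). [folklore] -/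
theorem d0_assembly (h₁ : SemistableDegreeConjecture)
    (h₂ : SemistableDegreeConjecture → SharpDegreeOfPolyDegree) : SharpDegreeOfPolyDegree :=
  h₂ h₁

/-- D0, piece 2 is PROVED trivially (landed `stub_ofTarget`, p96259). [folklore] -/
theorem d0_piece2_proved : SemistableDegreeConjecture → SharpDegreeOfPolyDegree :=
  Summit.ABC.ABC.Theorems.SharpDegreeOfPolyDegree.stub_ofTarget

/-- D0, piece 1 gives the summit on its own (the route's proved frame, modulo the analytic item
`PeterssonLowerBound`): criterion (c) fails, and with one open piece RULE-N applies. [folklore] -/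
theorem d0_piece1_gives_summit (hP : PeterssonLowerBound) (hX : SemistableDegreeConjecture) :
    _root_.ABC :=
  Summit.ABC.ABC.Theorems.frameOverPetersson_proof hP hX

/-! ## §2 D6 — the bridge through the summit (`(Poly → S) ∧ (S → X)`) -/

/-- D6, piece 1: "`R` on Frey curves" = polynomial modular degree ⟹ abc. [folklore] -/
def PolyImpAbc : Prop := Poly → _root_.ABC

/-- D6, piece 2: abc ⟹ the modular-degree conjecture for semistable curves (Murty 1999 Thm 1 (ii)).
[folklore] -/
def AbcImpTarget : Prop := _root_.ABC → SemistableDegreeConjecture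

/-- D6 assembly (composition). [folklore] -/
theorem d6_assembly (h₁ : PolyImpAbc) (h₂ : AbcImpTarget) : SharpDegreeOfPolyDegree :=
  fun hP => h₂ (h₁ hP)

/-- D6, piece 2 is PROVED modulo three named known-in-print inputs (modularity with Edixhoven's
integral Manin constant; `|c₀| = 1` for the semistable optimal curve; Mazur–Kenku), landed p99967.
[cite: MurtyCongruencePrimes1999, Thm. 1 (ii)] -/
theorem d6_piece2_of_facts (hOpt : exists_optimal_modularParametrizationData)
    (hc1 : ∀ {N : ℕ} [NeZero N] {W₀ : WeierstrassCurve ℚ} (D₀ : ModularParametrizationData W₀ N),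
      D₀.abs_maninConstant_eq_one_of_isSemistable)
    (hMK : MazurKenkuBound) : AbcImpTarget :=
  Summit.ABC.ABC.Theorems.SharpDegreeOfPolyDegree.semistableDegreeConjecture_of_abc_of_facts
    hOpt hc1 hMK

/-- D6, piece 1 IS the crux modulo the four named inputs (landed iff, p99967): criterion (c) fails
("no landed iff"), and with one open piece RULE-N applies. [cite: MurtyCongruencePrimes1999, Thm. 1] -/
theorem d6_piece1_iff_crux_of_facts (hP : PeterssonLowerBound)
    (hOpt : exists_optimal_modularParametrizationData)
    (hc1 : ∀ {N : ℕ} [NeZero N] {W₀ : WeierstrassCurve ℚ} (D₀ : ModularParametrizationData W₀ N),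
      D₀.abs_maninConstant_eq_one_of_isSemistable)
    (hMK : MazurKenkuBound) : PolyImpAbc ↔ SharpDegreeOfPolyDegree :=
  (Summit.ABC.ABC.Theorems.SharpDegreeOfPolyDegree.sharpDegreeOfPolyDegree_iff_poly_imp_abc_of_facts
    hP hOpt hc1 hMK).symm

/-! ## §3 D1 — the `Δ / c₄` seam of generalized Szpiro -/

/-- D1, piece 1: under Poly, the discriminant face of sharp Szpiro ("polynomial Szpiro ⟹ Szpiro";
on Frey curves: polynomial abc ⟹ `abc ≤ C rad^{3+ε}`, i.e. abc with exponent `3/2`). [folklore] -/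
def DiscSharpOfPoly : Prop := Poly → DiscSharp

/-- D1, piece 2: under Poly, the discriminant face implies the target (contains the classical open
"Szpiro ⟹ modified Szpiro / abc"). [folklore] -/
def SharpOfDiscSharp : Prop := Poly → DiscSharp → SemistableDegreeConjecture

/-- D1 assembly (one-line seam; flag `trivial_seam`). [folklore] -/
theorem d1_assembly (h₁ : DiscSharpOfPoly) (h₂ : SharpOfDiscSharp) : SharpDegreeOfPolyDegree :=
  fun hP => h₂ hP (h₁ hP)

/-! ## §4 D5 — the two faces as separate pieces, and why the `c₄`-piece is the crux again -/

/-- D5, the `c₄`-piece: under Poly, the Hall face of sharp Szpiro. [folklore] -/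
def C4SharpOfPoly : Prop := Poly → C4Sharp

/-- D5, the glue piece: both sharp faces give the target (Murty 1999 Thm 1 (ii) shape). [folklore] -/
def TargetOfFaces : Prop := DiscSharp → C4Sharp → SemistableDegreeConjecture

/-- D5 assembly. [folklore] -/
theorem d5_assembly (h₁ : DiscSharpOfPoly) (h₂ : C4SharpOfPoly) (h₃ : TargetOfFaces) :
    SharpDegreeOfPolyDegree :=
  fun hP => h₃ (h₁ hP) (h₂ hP)

/-- **The sharp `c₄`-face alone gives abc on the triples with `16 ∣ abc`.** For the Serre-normalised
Frey–Hellegouarch curve `W = freyIntModel₂ A B` of such a triple (semistable, global minimal equation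
(12.18), `N_W ∣ rad(abc)`) one has `c² ≤ 2 c₄(W)`, so `|c₄|³ ≤ C N^{6+6ε}` gives
`c⁶ ≤ 8 C rad(abc)^{6+6ε}`. [cite: BombieriGubler2006, Ex. 12.5.10] -/
theorem abcLe_sixteen_of_c4Sharp (h : C4Sharp) :
    ∀ ε : ℝ, 0 < ε → ∃ C : ℝ, ∀ a b c : ℕ, IsABCTriple a b c → 16 ∣ a * b * c →
      (c : ℝ) ≤ C * ((rad a b c : ℕ) : ℝ) ^ (1 + ε) := by
  intro ε hε
  obtain ⟨C₀, hC₀⟩ := h (6 * ε) (by positivity)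
  set M : ℝ := 8 * max C₀ 0 with hMdef
  have hM : 0 ≤ M := by positivity
  refine ⟨M ^ (1 / 6 : ℝ), fun a b c habc h16 ↦ ?_⟩
  have h' := habc
  obtain ⟨ha, hb, hsum, hcop⟩ := h'
  have hc0 : 0 < c := by omega
  have habc0 : a * b * c ≠ 0 := by positivity
  set R : ℝ := ((rad a b c : ℕ) : ℝ) with hRdef
  have hRpos : 0 < rad a b c := by
    rw [rad_def]; exact Nat.pos_of_ne_zero radical_ne_zero
  have hR0 : (0 : ℝ) ≤ R := by positivity
  -- Serre's normalisation and the semistable global minimal equation (12.18)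
  obtain ⟨A, B, hAB, hA4, hB, hprod, hquad⟩ := exists_arrangement habc h16
  have h0 : A * B * (A + B) ≠ 0 := by
    rw [← Int.natAbs_ne_zero, hprod]; exact habc0
  have h4 : 4 ∣ B - A - 1 := by
    have : B - A - 1 = B - (A + 1) := by ring
    rw [this]; exact dvd_sub (dvd_trans (by norm_num) hB) hA4
  have h16' : 16 ∣ A * B := dvd_mul_of_dvd_right hB _
  set W : WeierstrassCurve ℚ := (freyIntModel₂ A B).baseChange ℚ with hWdef
  haveI : W.IsElliptic := isElliptic_freyIntModel₂ h0 h4 h16'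
  haveI : W.IsGloballyMinimal :=
    isGloballyMinimal_of_forall_isMinimalAt_int _ (isMinimalAt_freyIntModel₂ hAB hA4 hB)
  have hN0 : 0 < W.conductorNorm ℤ := conductorNorm_pos_holds W
  haveI : NeZero (W.conductorNorm ℤ) := ⟨hN0.ne'⟩
  have hss : W.IsSemistable ℤ := fun v ↦ isSemistableAt_freyIntModel₂ hAB h0 hA4 hB v
  set Nn : ℕ := W.conductorNorm ℤ with hNn
  -- the hypothesis on `W`
  have hbound := hC₀ W hss
  have hc₄W : W.c₄ = ((freyIntModel₂ A B).c₄ : ℚ) := by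
    simp [hWdef, WeierstrassCurve.baseChange, WeierstrassCurve.map_c₄]
  -- `c² ≤ 2 c₄'`
  have hcc4 : (c : ℝ) ^ 2 ≤ 2 * |((freyIntModel₂ A B).c₄ : ℝ)| := by
    rw [freyIntModel₂_c₄ h4 h16']
    have hq : (0 : ℤ) ≤ A ^ 2 + A * B + B ^ 2 := by
      nlinarith [sq_nonneg (A + B), sq_nonneg A, sq_nonneg B]
    have hz : ((c : ℕ) : ℤ) ^ 2 ≤ 2 * |A ^ 2 + A * B + B ^ 2| := by
      rw [abs_of_nonneg hq, hquad]; nlinarith [sq_nonneg (a : ℤ), sq_nonneg (b : ℤ)]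
    have hzr : (((c : ℕ) : ℤ) : ℝ) ^ 2 ≤ 2 * |((A ^ 2 + A * B + B ^ 2 : ℤ) : ℝ)| := by
      exact_mod_cast hz
    simpa using hzr
  -- `N ∣ rad(abc)`, so `N ≤ rad(abc)`
  have hdvd : Nn ∣ rad a b c := by
    rw [hNn, hWdef, rad_def, ← hprod]
    exact conductorNorm_freyIntModel₂_dvd hAB h0 hA4 hB
  have hNR : ((Nn : ℕ) : ℝ) ≤ R := by
    rw [hRdef]; exact_mod_cast Nat.le_of_dvd hRpos hdvd
  have hNpos : (0 : ℝ) < ((Nn : ℕ) : ℝ) := by exact_mod_cast hN0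
  have hc4abs : |((freyIntModel₂ A B).c₄ : ℝ)| ^ 3 = ((|W.c₄| ^ 3 : ℚ) : ℝ) := by
    rw [hc₄W]; norm_cast
  -- `c⁶ ≤ 8 |c₄'|³ ≤ 8 C₀ N^{6+6ε} ≤ M · rad^{6+6ε}`
  have h6 : (c : ℝ) ^ 6 ≤ M * R ^ (6 + 6 * ε) := by
    have h1 : (c : ℝ) ^ 6 = ((c : ℝ) ^ 2) ^ 3 := by ring
    have h2 : ((c : ℝ) ^ 2) ^ 3 ≤ (2 * |((freyIntModel₂ A B).c₄ : ℝ)|) ^ 3 :=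
      pow_le_pow_left₀ (by positivity) hcc4 3
    have h3 : (2 * |((freyIntModel₂ A B).c₄ : ℝ)|) ^ 3 = 8 * ((|W.c₄| ^ 3 : ℚ) : ℝ) := by
      rw [mul_pow, hc4abs]; norm_num
    have h5 : ((|W.c₄| ^ 3 : ℚ) : ℝ) ≤ max C₀ 0 * R ^ (6 + 6 * ε) := by
      calc ((|W.c₄| ^ 3 : ℚ) : ℝ) ≤ C₀ * ((Nn : ℕ) : ℝ) ^ (6 + 6 * ε) := hbound
        _ ≤ max C₀ 0 * ((Nn : ℕ) : ℝ) ^ (6 + 6 * ε) :=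
            mul_le_mul_of_nonneg_right (le_max_left _ _) (by positivity)
        _ ≤ max C₀ 0 * R ^ (6 + 6 * ε) := by
            apply mul_le_mul_of_nonneg_left _ (le_max_right _ _)
            exact Real.rpow_le_rpow hNpos.le hNR (by positivity)
    calc (c : ℝ) ^ 6 = ((c : ℝ) ^ 2) ^ 3 := h1
      _ ≤ (2 * |((freyIntModel₂ A B).c₄ : ℝ)|) ^ 3 := h2
      _ = 8 * ((|W.c₄| ^ 3 : ℚ) : ℝ) := h3
      _ ≤ 8 * (max C₀ 0 * R ^ (6 + 6 * ε)) := by gcongr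
      _ = M * R ^ (6 + 6 * ε) := by rw [hMdef]; ring
  -- sixth roots
  have hc6 : (c : ℝ) = ((c : ℝ) ^ 6) ^ (1 / 6 : ℝ) := by
    rw [← Real.rpow_natCast, ← Real.rpow_mul (Nat.cast_nonneg c)]
    norm_num
  calc (c : ℝ) = ((c : ℝ) ^ 6) ^ (1 / 6 : ℝ) := hc6
    _ ≤ (M * R ^ (6 + 6 * ε)) ^ (1 / 6 : ℝ) :=
        Real.rpow_le_rpow (by positivity) h6 (by norm_num)
    _ = M ^ (1 / 6 : ℝ) * R ^ (1 + ε) := by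
        rw [Real.mul_rpow hM (Real.rpow_nonneg hR0 _), ← Real.rpow_mul hR0]
        congr 1
        ring_nf

/-- **The sharp `c₄`-face alone gives the summit** (`≤`-form on `16 ∣ abc`, the elementary
`(u⁸, v⁸ − u⁸, v⁸)` reduction `abcLe_of_abcLe_sixteen_dvd`, then the strict form `abcLt_of_abcLe`).
[cite: BombieriGubler2006, Thm. 12.5.12] -/
theorem abc_of_c4Sharp (h : C4Sharp) : _root_.ABC :=
  ABC_iff.mpr (abcLt_of_abcLe (abcLe_of_abcLe_sixteen_dvd (abcLe_sixteen_of_c4Sharp h)))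

/-- Hence the `c₄`-piece of D5 gives the crux on its own, modulo the three named known-in-print inputs
of `…OfAbc` — criterion (c) fails for it. [cite: MurtyCongruencePrimes1999, Thm. 1 (ii)] -/
theorem crux_of_c4SharpOfPoly_of_facts (hOpt : exists_optimal_modularParametrizationData)
    (hc1 : ∀ {N : ℕ} [NeZero N] {W₀ : WeierstrassCurve ℚ} (D₀ : ModularParametrizationData W₀ N),
      D₀.abs_maninConstant_eq_one_of_isSemistable)
    (hMK : MazurKenkuBound) (h : C4SharpOfPoly) : SharpDegreeOfPolyDegree :=
  fun hP =>
    Summit.ABC.ABC.Theorems.SharpDegreeOfPolyDegree.semistableDegreeConjecture_of_abc_of_facts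
      hOpt hc1 hMK (abc_of_c4Sharp (h hP))

/-- The glue piece of D5 is PROVED modulo the same three inputs — with the `Δ`-face IDLE, which is
the kernel-level form of "the `c₄`-face carries the whole crux". [folklore] -/
theorem targetOfFaces_of_facts (hOpt : exists_optimal_modularParametrizationData)
    (hc1 : ∀ {N : ℕ} [NeZero N] {W₀ : WeierstrassCurve ℚ} (D₀ : ModularParametrizationData W₀ N),
      D₀.abs_maninConstant_eq_one_of_isSemistable)
    (hMK : MazurKenkuBound) : TargetOfFaces :=
  fun _ h4 =>
    Summit.ABC.ABC.Theorems.SharpDegreeOfPolyDegree.semistableDegreeConjecture_of_abc_of_facts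
      hOpt hc1 hMK (abc_of_c4Sharp h4)

/-- **`X` ⟹ sharp generalized Szpiro for semistable curves** (`max(|Δ_W|, |c₄|³) ≤ C(ε) N^{6+ε}`),
modulo the analytic item `PeterssonLowerBound`: Zagier's identity (proved), `c ∈ ℤ ∖ {0}` (proved),
`(f,f) ≥ c₂ N^{1−δ}`, Silverman's `max(|Δ|,|c₄|³) ≤ A covol^{−(6+δ)}` on the global minimal model
(proved), with `(1 + 2δ)(6 + δ) ≤ 6 + ε`. [cite: MurtyCongruencePrimes1999, Thm. 1 (i) and §2] -/
theorem genSzpiro_of_target (hP : PeterssonLowerBound) (hX : SemistableDegreeConjecture) :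
    ∀ ε : ℝ, 0 < ε → ∃ C : ℝ, ∀ (W : WeierstrassCurve ℚ) [W.IsElliptic] [W.IsGloballyMinimal]
      [NeZero (W.conductorNorm ℤ)], W.IsSemistable ℤ →
        ((max |W.Δ| (|W.c₄| ^ 3) : ℚ) : ℝ) ≤ C * (W.conductorNorm ℤ : ℝ) ^ (6 + ε) := by
  intro ε hε
  set δ : ℝ := min 1 (ε / 16) with hδdef
  have hδ : 0 < δ := lt_min one_pos (by positivity)
  have hδ1 : δ ≤ 1 := min_le_left _ _
  have hδε : 16 * δ ≤ ε := by have := min_le_right 1 (ε / 16); linarith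
  obtain ⟨C₀, hC₀⟩ := hX δ hδ
  obtain ⟨c₂, hc₂, hPc⟩ := hP δ hδ
  obtain ⟨A₀, hA₀⟩ := silverman1986_discriminant_c4_covolume_holds δ hδ
  set C₁ : ℝ := max C₀ 1 with hC₁def
  have hC₁ : 0 < C₁ := lt_of_lt_of_le one_pos (le_max_right _ _)
  set K : ℝ := 4 * Real.pi ^ 2 * c₂ / C₁ with hKdef
  have hK : 0 < K := by positivity
  refine ⟨max A₀ 0 * K ^ (-(6 + δ)), fun W _ _ _ hss => ?_⟩
  obtain ⟨D, hD⟩ := hC₀ W hss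
  set N : ℕ := W.conductorNorm ℤ with hNdef
  have hN : (0 : ℝ) < N := by exact_mod_cast Nat.pos_of_ne_zero (NeZero.ne N)
  have hN1 : (1 : ℝ) ≤ N := by exact_mod_cast Nat.pos_of_ne_zero (NeZero.ne N)
  have hc : (D.c : ℝ) ≠ 0 := by exact_mod_cast D.maninConstant_ne_zero_holds
  have hcov : 0 < ZLattice.covolume D.L.lattice := ZLattice.covolume_pos _ _
  -- Zagier's identity, real form
  have hZ := congrArg Complex.re D.zagier_degree_formula_holds
  rw [Complex.re_ofReal_mul, Complex.ofReal_re] at hZ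
  -- the degree bound in `c²`-form
  have hdeg : (D.deg : ℝ) ≤ C₁ * (D.c : ℝ) ^ 2 * (N : ℝ) ^ (2 + δ) := by
    have hc1 : (1 : ℝ) ≤ (D.c : ℝ) ^ 2 := by
      have h1 : (1 : ℤ) ≤ D.c ^ 2 := by
        have h0' : D.c ≠ 0 := D.maninConstant_ne_zero_holds
        nlinarith [Int.one_le_abs h0', sq_abs D.c]
      exact_mod_cast h1
    have hN0' : (0 : ℝ) ≤ (N : ℝ) ^ (2 + δ) := by positivity
    calc (D.deg : ℝ) = (D.modularDegree : ℝ) := rfl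
      _ ≤ C₀ * (N : ℝ) ^ (2 + δ) := hD
      _ ≤ C₁ * (N : ℝ) ^ (2 + δ) := mul_le_mul_of_nonneg_right (le_max_left _ _) hN0'
      _ = C₁ * 1 * (N : ℝ) ^ (2 + δ) := by ring
      _ ≤ C₁ * (D.c : ℝ) ^ 2 * (N : ℝ) ^ (2 + δ) :=
          mul_le_mul_of_nonneg_right (mul_le_mul_of_nonneg_left hc1 hC₁.le) hN0'
  -- Petersson lower bound for the newform of `D`
  have hPD : c₂ * (N : ℝ) ^ (1 - δ) ≤ (peterssonProduct (Gamma0 N) 2 D.f D.f).re :=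
    hPc N W D.f D.isNewformOf
  -- covolume lower bound (the Manin constant cancels)
  have hlow := covolume_ge_of_zagier_exp hN hC₁ hc hcov hZ hdeg hPD
  have hlow' : K * (N : ℝ) ^ (-(1 + δ + δ)) ≤ ZLattice.covolume D.L.lattice := by
    rw [hKdef]; exact hlow
  have hx : 0 < K * (N : ℝ) ^ (-(1 + δ + δ)) := by positivity
  -- Silverman on the global minimal model `W`
  have hSW := hA₀ W D.L D.isNeronLattice
  have hpos : 0 ≤ ZLattice.covolume D.L.lattice ^ (-(6 + δ)) := Real.rpow_nonneg hcov.le _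
  have h1 : ((max |W.Δ| (|W.c₄| ^ 3) : ℚ) : ℝ) ≤
      max A₀ 0 * ZLattice.covolume D.L.lattice ^ (-(6 + δ)) :=
    hSW.trans (mul_le_mul_of_nonneg_right (le_max_left _ _) hpos)
  have h2 : ZLattice.covolume D.L.lattice ^ (-(6 + δ)) ≤
      (K * (N : ℝ) ^ (-(1 + δ + δ))) ^ (-(6 + δ)) :=
    Real.rpow_le_rpow_of_nonpos hx hlow' (by linarith)
  have h3 : (K * (N : ℝ) ^ (-(1 + δ + δ))) ^ (-(6 + δ)) =
      K ^ (-(6 + δ)) * (N : ℝ) ^ ((1 + δ + δ) * (6 + δ)) := by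
    rw [Real.mul_rpow hK.le (Real.rpow_nonneg hN.le _), ← Real.rpow_mul hN.le]
    congr 1
    ring_nf
  have hδ2 : δ * δ ≤ δ := by nlinarith
  have h4 : (N : ℝ) ^ ((1 + δ + δ) * (6 + δ)) ≤ (N : ℝ) ^ (6 + ε) := by
    apply Real.rpow_le_rpow_of_exponent_le hN1
    nlinarith
  have hKpos : 0 ≤ max A₀ 0 * K ^ (-(6 + δ)) := by positivity
  calc ((max |W.Δ| (|W.c₄| ^ 3) : ℚ) : ℝ)
      ≤ max A₀ 0 * ZLattice.covolume D.L.lattice ^ (-(6 + δ)) := h1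
    _ ≤ max A₀ 0 * (K * (N : ℝ) ^ (-(1 + δ + δ))) ^ (-(6 + δ)) :=
        mul_le_mul_of_nonneg_left h2 (le_max_right _ _)
    _ = max A₀ 0 * K ^ (-(6 + δ)) * (N : ℝ) ^ ((1 + δ + δ) * (6 + δ)) := by
        rw [h3]; ring
    _ ≤ max A₀ 0 * K ^ (-(6 + δ)) * (N : ℝ) ^ (6 + ε) :=
        mul_le_mul_of_nonneg_left h4 hKpos

/-- `X` ⟹ the sharp `c₄`-face (modulo `PeterssonLowerBound`). [folklore] -/
theorem c4Sharp_of_target (hP : PeterssonLowerBound) (hX : SemistableDegreeConjecture) : C4Sharp := by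
  intro ε hε
  obtain ⟨C, hC⟩ := genSzpiro_of_target hP hX ε hε
  refine ⟨C, fun W _ _ _ hss => le_trans ?_ (hC W hss)⟩
  exact_mod_cast le_max_right _ _

/-- `X` ⟹ the sharp `Δ`-face (modulo `PeterssonLowerBound`). [folklore] -/
theorem discSharp_of_target (hP : PeterssonLowerBound) (hX : SemistableDegreeConjecture) :
    DiscSharp := by
  intro ε hε
  obtain ⟨C, hC⟩ := genSzpiro_of_target hP hX ε hε
  refine ⟨C, fun W _ _ _ hss => le_trans ?_ (hC W hss)⟩
  exact_mod_cast le_max_left _ _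

/-- `R` ⟹ the `c₄`-piece of D5 (modulo `PeterssonLowerBound`). [folklore] -/
theorem c4SharpOfPoly_of_crux (hP : PeterssonLowerBound) (hR : SharpDegreeOfPolyDegree) :
    C4SharpOfPoly :=
  fun hPoly => c4Sharp_of_target hP (hR hPoly)

/-- **The `c₄`-piece of D5 is the crux again**, modulo the four named inputs
{`PeterssonLowerBound`, `exists_optimal_modularParametrizationData`,
`abs_maninConstant_eq_one_of_isSemistable`, `MazurKenkuBound`} — a kernel-checked failure of
criterion (c) for the two-faces split. [cite: MurtyCongruencePrimes1999, Thm. 1] -/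
theorem c4SharpOfPoly_iff_crux_of_facts (hP : PeterssonLowerBound)
    (hOpt : exists_optimal_modularParametrizationData)
    (hc1 : ∀ {N : ℕ} [NeZero N] {W₀ : WeierstrassCurve ℚ} (D₀ : ModularParametrizationData W₀ N),
      D₀.abs_maninConstant_eq_one_of_isSemistable)
    (hMK : MazurKenkuBound) : C4SharpOfPoly ↔ SharpDegreeOfPolyDegree :=
  ⟨crux_of_c4SharpOfPoly_of_facts hOpt hc1 hMK, c4SharpOfPoly_of_crux hP⟩

/-! ### Back to D1: both pieces are consequences of `R`; the second is exactly the Hall face -/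

/-- `R` ⟹ D1 piece 1 (modulo `PeterssonLowerBound`). [folklore] -/
theorem discSharpOfPoly_of_crux (hP : PeterssonLowerBound) (hR : SharpDegreeOfPolyDegree) :
    DiscSharpOfPoly :=
  fun hPoly => discSharp_of_target hP (hR hPoly)

/-- `R` ⟹ D1 piece 2 (trivially: the extra hypothesis is dropped). [folklore] -/
theorem sharpOfDiscSharp_of_crux (hR : SharpDegreeOfPolyDegree) : SharpOfDiscSharp :=
  fun hPoly _ => hR hPoly

/-- D1 piece 2 in HALL form: under Poly and the sharp `Δ`-face, the sharp `c₄`-face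
(`|c₄³ − c₆²| = 1728 |Δ| ≤ C N^{6+ε}` and `|c₄|³ ≤ C N^K` ⟹ `|c₄|³ ≤ C N^{6+ε}`). [folklore] -/
def HallFaceOfDiscSharp : Prop := Poly → DiscSharp → C4Sharp

/-- **D1 piece 2 is EXACTLY the Hall face**, modulo the four named inputs: `SharpOfDiscSharp ↔
(Poly → DiscSharp → C4Sharp)`.  So the `Δ / c₄` seam isolates, as its second piece, "polynomial
Hall + sharp `Δ`-Szpiro ⟹ sharp Hall face" — on Frey curves: `abc ≤ C rad^{3+ε}` ⟹ `c ≤ C rad^{1+ε}`,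
an exponent drop `3/2 ↦ 1` of abc type. [folklore] -/
theorem sharpOfDiscSharp_iff_hallFace_of_facts (hP : PeterssonLowerBound)
    (hOpt : exists_optimal_modularParametrizationData)
    (hc1 : ∀ {N : ℕ} [NeZero N] {W₀ : WeierstrassCurve ℚ} (D₀ : ModularParametrizationData W₀ N),
      D₀.abs_maninConstant_eq_one_of_isSemistable)
    (hMK : MazurKenkuBound) : SharpOfDiscSharp ↔ HallFaceOfDiscSharp :=
  ⟨fun h hPoly hDisc => c4Sharp_of_target hP (h hPoly hDisc),
    fun g hPoly hDisc =>
      Summit.ABC.ABC.Theorems.SharpDegreeOfPolyDegree.semistableDegreeConjecture_of_abc_of_facts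
        hOpt hc1 hMK (abc_of_c4Sharp (g hPoly hDisc))⟩

/-! ## §5 D2 — the exponent ladder at a waypoint `κ₁` -/

/-- D2, upper piece: Poly ⟹ the bound at the waypoint exponent `κ₁`. [folklore] -/
def LadderUp (κ₁ : ℝ) : Prop := Poly → DegAt κ₁

/-- D2, lower piece: the bound at `κ₁` ⟹ the target. [folklore] -/
def LadderDown (κ₁ : ℝ) : Prop := DegAt κ₁ → SemistableDegreeConjecture

/-- D2 assembly (one-line seam). [folklore] -/
theorem d2_assembly (κ₁ : ℝ) (h₁ : LadderUp κ₁) (h₂ : LadderDown κ₁) : SharpDegreeOfPolyDegree :=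
  fun hP => h₂ (h₁ hP)

theorem degAt_mono {κ κ' : ℝ} (h : κ ≤ κ') (hκ : DegAt κ) : DegAt κ' :=
  Summit.ABC.ABC.Theorems.SharpDegreeOfPolyDegree.Negative.degreeBound_mono h hκ

/-- `R` ⟹ the upper piece, for every waypoint `κ₁ > 2`. [folklore] -/
theorem ladderUp_of_crux {κ₁ : ℝ} (hκ₁ : 2 < κ₁) (hR : SharpDegreeOfPolyDegree) : LadderUp κ₁ := by
  intro hPoly
  have hX := hR hPoly
  have h := hX (κ₁ - 2) (by linarith)
  rwa [show (2 : ℝ) + (κ₁ - 2) = κ₁ by ring] at h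

/-- `R` ⟹ the lower piece, for every waypoint. [folklore] -/
theorem ladderDown_of_crux {κ₁ : ℝ} (hR : SharpDegreeOfPolyDegree) : LadderDown κ₁ :=
  fun h => hR ⟨κ₁, h⟩

/-- The lower piece is FREE for `κ₁ ≤ 2` (monotonicity) — then the upper piece is the whole crux.
[folklore] -/
theorem ladderDown_of_le_two {κ₁ : ℝ} (hκ₁ : κ₁ ≤ 2) : LadderDown κ₁ :=
  fun h ε hε => degAt_mono (by linarith) h

/-- … indeed for `κ₁ ≤ 2` the upper piece implies `R` outright. [folklore] -/
theorem crux_of_ladderUp_of_le_two {κ₁ : ℝ} (hκ₁ : κ₁ ≤ 2) (h : LadderUp κ₁) :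
    SharpDegreeOfPolyDegree :=
  d2_assembly κ₁ h (ladderDown_of_le_two hκ₁)

/-- Below the unconditional exponent floor `3/2` the upper piece is the NEGATION of Poly (Masser's
semistable curves, `Negative.ExponentFloor`): a ladder through `κ₁ < 3/2` is the vacuous line.
[cite: Masser1990, Theorem] -/
theorem ladderUp_iff_not_poly {κ₁ : ℝ} (hκ₁ : κ₁ < 3 / 2) : LadderUp κ₁ ↔ ¬ Poly :=
  ⟨fun h hPoly =>
      Summit.ABC.ABC.Theorems.SharpDegreeOfPolyDegree.Negative.not_degreeBound_of_lt_three_halves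
        hκ₁ (h hPoly),
    fun h hPoly => absurd hPoly h⟩

/-- For `κ₁ > 2` the lower piece is an INSTANCE of `R` (`R ↔ ∀ κ > 2, LadderDown κ`, landed as
`Disproof.crux_iff_forall_gt_two`); here the packaged form: `R ↔ ∀ κ₁ > 2, LadderDown κ₁`.
[folklore] -/
theorem crux_iff_forall_ladderDown :
    SharpDegreeOfPolyDegree ↔ ∀ κ₁ : ℝ, 2 < κ₁ → LadderDown κ₁ := by
  constructor
  · exact fun hR κ₁ _ => ladderDown_of_crux hR
  · rintro h ⟨κ, hκ⟩
    rcases le_or_gt κ 2 with hle | hlt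
    · exact ladderDown_of_le_two hle hκ
    · exact h κ hlt hκ

end Summit.ABC.ABC.Cruxes.SharpDegreeOfPolyDegree.ReExam46

end
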